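import Summits.MatrixMultiplication.OmegaCensus.STPPVosperSlackFourRows61F5A11
import Summits.MatrixMultiplication.OmegaCensus.STPPVosperSlackFourRows61F5A12
import Summits.MatrixMultiplication.OmegaCensus.STPPVosperSlackFourRows61F5A13
import Summits.MatrixMultiplication.OmegaCensus.STPPVosperSlackFourRows61F5A14
import Summits.MatrixMultiplication.OmegaCensus.STPPVosperSlackFourRows61F5A15
import Summits.MatrixMultiplication.OmegaCensus.STPPVosperSlackFourRows61F5A16

/-!
# ω-census (abelian STPP census): fifth leaf ℤ₆₁ {(2,2,2),(3,3,3)²} — `rowsA1` assembled over the 39 hole pairs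

HONEST FRAMING (pub-omega census; verbatim): lottery ticket; floor = certified bounds/negative ranges.
Census STRUCTURE (seat pub-omega-stpp-2 gen 27, 2026-08-29), family (b2).  `rows61F5A1` = the literal `rowsA1` (and `rowsB1`) hypothesis of
`no_isSTPP_of_slack_four_tables_of_cell22` for the fifth leaf (a = b = 3, L = z = 13), by a 3 × 13 case split on `(h', k)`.  No new computation.
Nothing here is progress on `ω`.
-/

namespace Summit.MatrixMultiplication.OmegaCensus.CubeNB.S2

/-- **`rowsA1` for the fifth leaf**: all hole pairs. [folklore] -/
theorem rows61F5A1 : ∀ h' ∈ List.range' 1 3, ∀ k ∈ List.range' 1 13, ∀ Q ∈ qShapes 61 3 0 ((61 - 1).choose (3 - 1)),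
    dihedralSmaller 61 Q = true ∨ caseGDeadT 61 3 13 (3 + 13) ((List.range (3 + 1)).filter fun x => !(Nat.beq x h'))
      (((List.range (13 + 1)).filter fun x => !(Nat.beq x k)).map fun m => 3 + m) Q tblZ61F5A1 = true := by
  intro h' hh' k hk
  have hh := List.mem_range'_1.1 hh'
  have hkk := List.mem_range'_1.1 hk
  obtain ⟨hh1, hh2⟩ := hh
  obtain ⟨hk1, hk2⟩ := hkk
  interval_cases h' <;> interval_cases k
  · exact rows61F5A1_h1_k1
  · exact rows61F5A1_h1_k2
  · exact rows61F5A1_h1_k3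
  · exact rows61F5A1_h1_k4
  · exact rows61F5A1_h1_k5
  · exact rows61F5A1_h1_k6
  · exact rows61F5A1_h1_k7
  · exact rows61F5A1_h1_k8
  · exact rows61F5A1_h1_k9
  · exact rows61F5A1_h1_k10
  · exact rows61F5A1_h1_k11
  · exact rows61F5A1_h1_k12
  · exact rows61F5A1_h1_k13
  · exact rows61F5A1_h2_k1
  · exact rows61F5A1_h2_k2
  · exact rows61F5A1_h2_k3
  · exact rows61F5A1_h2_k4
  · exact rows61F5A1_h2_k5
  · exact rows61F5A1_h2_k6
  · exact rows61F5A1_h2_k7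
  · exact rows61F5A1_h2_k8
  · exact rows61F5A1_h2_k9
  · exact rows61F5A1_h2_k10
  · exact rows61F5A1_h2_k11
  · exact rows61F5A1_h2_k12
  · exact rows61F5A1_h2_k13
  · exact rows61F5A1_h3_k1
  · exact rows61F5A1_h3_k2
  · exact rows61F5A1_h3_k3
  · exact rows61F5A1_h3_k4
  · exact rows61F5A1_h3_k5
  · exact rows61F5A1_h3_k6
  · exact rows61F5A1_h3_k7
  · exact rows61F5A1_h3_k8
  · exact rows61F5A1_h3_k9
  · exact rows61F5A1_h3_k10
  · exact rows61F5A1_h3_k11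
  · exact rows61F5A1_h3_k12
  · exact rows61F5A1_h3_k13

end Summit.MatrixMultiplication.OmegaCensus.CubeNB.S2
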